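import Literature.Analysis.FluidPDE.ESSLocalHolderNoConcentration
import Literature.Analysis.FluidPDE.NSBoundedHigherRegularityQuantProofs
import HarnessLib

/-!
# `ess_local_holder_holds`: Escauriaza–Seregin–Šverák's local theorem (ESS 2003, Thm. 1.4)

Analysis/FluidPDE proof file (theorems only: no definition, no named fact, no `sorry`).  It composes
reductions that are already in the tree with the discharge of the quantitative higher-regularity
theorem for bounded distributional Navier–Stokes solutions, `NSBoundedHigherRegularityBounds_holds`
(`NSBoundedHigherRegularityQuantProofs.lean`; Seregin–Šverák 2009, §2 p. 8 = Serrin's interior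
regularity with constants, proved by the Serrin bootstrap `NSBootstrap*.lean`), which was the last
open hypothesis of each reduction used below.  No statement is changed; each `theorem X_holds : X`
turns the named fact `X` from literature debt into a theorem.
-/

namespace Literature.Analysis.FluidPDE

/-- **ESS 2003, Thm. 1.4 (the local theorem), proved**: `ess_local_holder` holds — the tree's reduction `ess_local_holder_of_higherRegularityBounds` (ESSLocalHolderNoConcentration.lean: ε-regularity, no concentration, the `C¹₂` backward-uniqueness chain) fed with `NSBoundedHigherRegularityBounds_holds`.
[cite: EscauriazaSereginSverak2003, Thm. 1.4] -/
theorem ess_local_holder_holds : ess_local_holder :=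
  ess_local_holder_of_higherRegularityBounds NSBoundedHigherRegularityBounds_holds

end Literature.Analysis.FluidPDE
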